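import Summits.BirchSwinnertonDyer.BirchSwinnertonDyer.Theorems.PrintCFramBottomClassIndexLawFiveLeCohenCutKronecker
import HarnessLib

/-!
# Crux `PrintCFram.BottomClassIndexLawFiveLe` (stmt-BirchSwinnertonDyer-20372), line `eisenstein-resource-bdp-line` (registry v23):
# THE COHEN DICTIONARY ON THE `m`-CUT — the coefficient `H(k, m·n₀·f²)` of the Cohen–Eisenstein series IS
# `−T_f · k⁻¹ · B_k((χ↑ε_K↑)~)`, read in `ℚ_p`
# (cell `bsd-print-cfram`, width seat `bsd-line-cfram-p1-w4` g12; THEOREMS ONLY, `--supports` 20372; BSD is not proved by any of this)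

HONEST FRAMING. Nothing here is a statement about BSD or about any curve; no registered stub is closed. Registry v23's
`stub_cutForm` (= (CutForm⁶), the `hcut` binder of `ThetaCycle.atP_six_of_cutForm`, w8 g6 p686877) is a TYPING statement:
the `m`-cut of Cohen's weight-`k + 1/2` Eisenstein series, reduced mod `p`, inside a Katz family, WITH THE DICTIONARY
«`coeff (m·n₀·f²) G = t · ι x`, `x = k⁻¹ B_k((χ↑ε_K↑)~)`, `t = 1` at `f = 1`» on the cut. That dictionary is item (D5) of the
typing memo (`Cruxes/…/Lines/eisenstein-resource-bdp-line-w8g6-notes.md` §3.1–3.2); with the Cohen numbers `H(k, N)` now a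
Literature DEFINITION (`ModularForms/CohenEisensteinCoefficients.lean`, item (D1)) it becomes a THEOREM, proved here in tree
vocabulary — so that what remains of (CutForm⁶) is exactly the three modular-form named facts NF-A (Cohen 1975 Thm 3.1 ×
`θ₀(Q²z)`), NF-C (periodic cut), NF-D (Katz 1973/1977) over the NAMED `q`-series `Σ H(k, a) qᵃ`.

For a class datum `(p, m, χ, k)` (`χ : DirichletCharacter ℚ_[p] m` PRIMITIVE QUADRATIC, parity `χ(−1)(−1)^k = −1`) and a cut
index `a = m·n₀·f²` (`n₀ ≡ 3 (mod 4)` squarefree, `f ≥ 1`, the cut's Jacobi clauses `J(−n₀f² | q) = 1` at the odd primes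
`q ∣ m`), with `K` imaginary quadratic of discriminant `−n₀` and `ε_K` its `ℚ_p`-valued Kronecker character
(`KrizLi2019.IsKroneckerCharacterOf K ε_K`):
* (part 1, `…CohenCutKronecker`: §1 Kronecker-symbol algebra, §2 `χ = χ_{e*}` with `e* = χ(−1)·m` fundamental or `1`, §3
  `ε_K = J(· | n₀)`.)
* §4 the level-`m·|d_K|` product `ψ = χ↑·ε_K↑`: values `χ_{D'}(c)`, `D' := e*·(−n₀)`; primitive
  (values of a fundamental discriminant ⟹ primitive); `B_k(ψ~) = B_k(ψ) = bernoulliDisc k D'` read in `ℚ_p`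
  (`CohenEisenstein.algebraMap_bernoulliDisc_eq_generalizedBernoulli`).
* §5 `isDiscDecomposition_cut` — `(−1)^k · (m n₀ f²) = D' · f²` IS Cohen's decomposition (sign from the parity clause).
* §6 **`cohenH_cut_eq`** (`H(k, m n₀ f²) = L(1−k, χ_{D'}) · T_k(D', f)`), **`ratCast_cohenH_cut_eq`**
  (`(H(k, m n₀ f²) : ℚ_p) = −T · (k⁻¹ · B_k((χ↑ε_K↑)~))`, `T = cohenT k D' f ∈ ℤ`), and the (CutForm⁶)-shaped
  **`exists_int_ratCast_cohenH_cut_eq`** (`∃ t : ℤ, (f = 1 → t = 1) ∧ (H : ℚ_p) = −t · (k⁻¹ B_k(…)~)`).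
`p`-integrality of `k⁻¹ B_k((χ↑ε_K↑)~)` (the `x : ℤ_[p]` of the dictionary) is the sequel file. beyond-print theorem: NO.

References: [Cohen1975] §2 (definition of `H(r, N)`), Thm. 3.1; [MontgomeryVaughan2007] Thm. 9.13; [Cox2013] §1.C Lemma 1.14;
[KrizLi2019] §2 (p. 12, `ε_K`); [Washington1997] Prop. 4.1, Thm. 4.2; crux notes `Lines/eisenstein-resource-bdp-line-w8g6-notes.md` §3.
-/

set_option autoImplicit false
-- summit-side namespace `Summit.BirchSwinnertonDyer.BirchSwinnertonDyer.…` (single-conjunct summit, D-0017 layout)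
set_option linter.dupNamespace false

noncomputable section

open scoped Classical NumberTheorySymbols
open NumberField DirichletCharacter
open Literature.NumberTheory.LFunctions Literature.NumberTheory.LFunctions.PrimitiveQuadratic
  Literature.NumberTheory.ModularForms.CohenEisenstein Literature.NumberTheory.EllipticCurves
  Literature.NumberTheory.EllipticCurves.KrizLi2019 Literature.NumberTheory.QuadraticFields

namespace Summit.BirchSwinnertonDyer.BirchSwinnertonDyer.Theorems.PrintCFram.CohenCut

open Summit.BirchSwinnertonDyer.BirchSwinnertonDyer.Theorems.PrintCFram

variable {p : ℕ} [hp : Fact p.Prime]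

/-! ## §4 The level-`m·|d_K|` product `χ↑·ε_K↑` -/

/-- `B_k` of a PRIMITIVE character equals `B_k` of its `primitiveCharacter` (which is the character itself, transported along
`conductor = level`). [cite: Washington1997, Prop. 4.1] -/
theorem generalizedBernoulli_primitiveCharacter_of_isPrimitive {R : Type*} [CommRing R] [Algebra ℚ R] {N : ℕ} [NeZero N]
    (k : ℕ) (ψ : DirichletCharacter R N) (hψ : ψ.IsPrimitive) :
    @generalizedBernoulli R _ _ ψ.conductor ⟨conductor_ne_zero _⟩ k ψ.primitiveCharacter = generalizedBernoulli k ψ := by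
  have key : ∀ {d : ℕ} (φ : DirichletCharacter R d) (h : d ∣ N) (hd : d = N) (hne : NeZero d),
      changeLevel h φ = ψ → @generalizedBernoulli R _ _ d hne k φ = generalizedBernoulli k ψ := by
    intro d φ h hd hne hφ
    subst hd
    rw [changeLevel_self] at hφ
    subst hφ
    rfl
  exact key ψ.primitiveCharacter ψ.conductor_dvd_level hψ _ ψ.changeLevel_primitiveCharacter

/-- `B_k` only depends on the level (as a number) and the values at the naturals. [cite: Washington1997, Prop. 4.1] -/
theorem generalizedBernoulli_eq_of_forall_natCast {R : Type*} [CommRing R] [Algebra ℚ R] {N N' : ℕ} [NeZero N] [NeZero N']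
    (h : N = N') (k : ℕ) (ψ : DirichletCharacter R N) (ψ' : DirichletCharacter R N')
    (hv : ∀ c : ℕ, ψ (c : ZMod N) = ψ' (c : ZMod N')) : generalizedBernoulli k ψ = generalizedBernoulli k ψ' := by
  subst h
  have : ψ = ψ' := MulChar.ext fun u => by
    have h := hv (u : ZMod N).val
    rwa [ZMod.natCast_zmod_val] at h
  subst this
  rfl

/-- The bridge of `CohenEisensteinCoefficients` at a level EQUAL to `|D|`: for `ψ` mod `N = |D|` with `ψ(c) = χ_D(c)` for all
`c`, `algebraMap ℚ R (bernoulliDisc k D) = B_k(ψ)`. [cite: Washington1997, Prop. 4.1] -/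
theorem algebraMap_bernoulliDisc_eq {R : Type*} [CommRing R] [Algebra ℚ R] (k : ℕ) {D : ℤ} {N : ℕ} [NeZero N]
    (hN : N = D.natAbs) (ψ : DirichletCharacter R N) (hψ : ∀ c : ℕ, ψ (c : ZMod N) = (chiDisc D c : R)) :
    algebraMap ℚ R (bernoulliDisc k D) = generalizedBernoulli k ψ := by
  subst hN
  exact algebraMap_bernoulliDisc_eq_generalizedBernoulli k ψ hψ

section Product

variable {m : ℕ} [NeZero m] {χ : DirichletCharacter ℚ_[p] m} {s : ℤ} {n₀ : ℕ} {K : Type} [Field K] [NumberField K]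
  {εK : DirichletCharacter ℚ_[p] (NumberField.discr K).natAbs}

omit [NeZero m] in
/-- The Jacobi clauses of the cut force `gcd(m, n₀) = 1`: at an odd prime `q ∣ m`, `J(−n₀f² | q) = 1 ≠ 0` gives `q ∤ n₀`, and
`2 ∤ n₀` since `n₀ ≡ 3 (mod 4)`. [cite: Cohen1975, Thm. 3.1] -/
theorem coprime_of_cut (h4 : n₀ % 4 = 3) {f : ℕ}
    (hJ : ∀ q : ℕ, q.Prime → q ∣ m → q ≠ 2 → jacobiSym (-((n₀ * f ^ 2 : ℕ) : ℤ)) q = 1) : m.Coprime n₀ := by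
  refine Nat.Coprime.symm (Nat.coprime_of_dvd fun q hq hqn hqm => ?_)
  by_cases hq2 : q = 2
  · subst hq2; omega
  · haveI : NeZero q := ⟨hq.ne_zero⟩
    have h1 := hJ q hq hqm hq2
    have h0 : jacobiSym (-((n₀ * f ^ 2 : ℕ) : ℤ)) q = 0 := by
      refine jacobiSym.eq_zero_iff_not_coprime.mpr fun hg => ?_
      rw [Int.gcd_eq_natAbs, Int.natAbs_neg, Int.natAbs_natCast, Int.natAbs_natCast] at hg
      have hdvd : q ∣ Nat.gcd (n₀ * f ^ 2) q := Nat.dvd_gcd (hqn.mul_right _) dvd_rfl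
      rw [hg] at hdvd
      exact hq.one_lt.ne' (Nat.dvd_one.mp hdvd)
    rw [h0] at h1; exact zero_ne_one h1

/-- **Values of `ψ = χ↑·ε_K↑` at level `m·|d_K|`: `ψ(c) = χ_{D'}(c)`, `D' = e*·(−n₀)`** (`e* = s·m`), for every `c : ℕ`
(at `c` prime to `m n₀`: product of the values of §2 and §3 and `chiDisc_mul`; otherwise both vanish).
[cite: MontgomeryVaughan2007, Thm. 9.13] [cite: KrizLi2019, §2 (p. 12, ε_K)] -/
theorem mul_apply_natCast_eq_chiDisc (hχ : χ.IsPrimitive) (hχq : χ.IsQuadratic) (hs : χ (-1) = (s : ℚ_[p]))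
    (hs1 : s = 1 ∨ s = -1) (hK2 : Module.finrank ℚ K = 2) (hsq : Squarefree n₀) (h4 : n₀ % 4 = 3)
    (hdisc : NumberField.discr K = -(n₀ : ℤ)) (hεK : IsKroneckerCharacterOf K εK) (c : ℕ) :
    (changeLevel (dvd_mul_right m (NumberField.discr K).natAbs) χ *
        changeLevel (dvd_mul_left (NumberField.discr K).natAbs m) εK) (c : ZMod (m * (NumberField.discr K).natAbs)) =
      (chiDisc (s * m * -(n₀ : ℤ)) c : ℚ_[p]) := by
  have hd : (NumberField.discr K).natAbs = n₀ := by rw [hdisc]; simp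
  have hn4 : (-(n₀ : ℤ)) % 4 = 1 := by omega
  obtain ⟨he, hs0⟩ := sign_mul_emod_four hχ hχq hs hs1
  haveI : NeZero (NumberField.discr K).natAbs := ⟨by rw [hd]; exact hsq.ne_zero⟩
  by_cases hc : c.Coprime (m * n₀)
  · -- product of the values at a unit
    have hcI : IsCoprime (c : ℤ) ((m * (NumberField.discr K).natAbs : ℕ) : ℤ) := by
      rw [hd]; exact Nat.isCoprime_iff_coprime.mpr hc
    rw [MulChar.mul_apply]
    have h1 := changeLevel_eq_cast_of_dvd' χ (dvd_mul_right m (NumberField.discr K).natAbs) hcI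
    have h2 := changeLevel_eq_cast_of_dvd' εK (dvd_mul_left (NumberField.discr K).natAbs m) hcI
    simp only [Int.cast_natCast] at h1 h2
    rw [h1, h2, apply_natCast_eq_chiDisc hχ hχq hs hs1 c, apply_natCast_eq_jacobiSym_of_isKroneckerCharacterOf hK2 hsq h4 hdisc hεK c,
      ← chiDisc_mul_jacobiSym he hs0 h4 c, Int.cast_mul]
  · -- both sides vanish off the units
    have hnu : ¬ IsUnit ((c : ℕ) : ZMod (m * (NumberField.discr K).natAbs)) := by
      rw [ZMod.isUnit_iff_coprime, hd]; exact hc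
    rw [MulChar.map_nonunit _ hnu]
    have hD : (s * m * -(n₀ : ℤ)) % 4 = 1 ∨ 4 ∣ (s * m * -(n₀ : ℤ)) := by
      rcases he with he | he
      · left; rw [Int.mul_emod, he, hn4]; decide
      · exact Or.inr (dvd_mul_of_dvd_left he _)
    have hc' : ¬ c.Coprime (s * m * -(n₀ : ℤ)).natAbs := by
      rwa [Int.natAbs_mul, Int.natAbs_neg, Int.natAbs_natCast, show (s * m : ℤ).natAbs = m by
        rcases hs1 with rfl | rfl <;> simp]
    rw [chiDisc_eq_zero_of_not_coprime hD hc', Int.cast_zero]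

/-- **`ψ = χ↑·ε_K↑` is PRIMITIVE of conductor `m·|d_K|`**: its values are those of the Kronecker character of the FUNDAMENTAL
discriminant `D' = e*·(−n₀)` (`mul_apply_natCast_eq_chiDisc`, `isFundamental_mul_neg`), and a `ℚ_p`-valued character with the
Kronecker values of a fundamental discriminant is primitive (parts K-odd / K-even of the Kriz–Li binders:
`KrizLiBinders.isPrimitive_of_forall_eq_jacobiSym`, `…_of_forall_eq_kroneckerFour'`).
[cite: MontgomeryVaughan2007, Thm. 9.13] [cite: KrizLi2019, §2 (p. 11, conventions on primitive characters)] -/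
theorem mul_isPrimitive (hχ : χ.IsPrimitive) (hχq : χ.IsQuadratic) (hs : χ (-1) = (s : ℚ_[p])) (hs1 : s = 1 ∨ s = -1)
    (hK2 : Module.finrank ℚ K = 2) (hsq : Squarefree n₀) (h4 : n₀ % 4 = 3) (hdisc : NumberField.discr K = -(n₀ : ℤ))
    (hεK : IsKroneckerCharacterOf K εK) (hcop : m.Coprime n₀) :
    (changeLevel (dvd_mul_right m (NumberField.discr K).natAbs) χ *
        changeLevel (dvd_mul_left (NumberField.discr K).natAbs m) εK).IsPrimitive := by
  have hd : (NumberField.discr K).natAbs = n₀ := by rw [hdisc]; simp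
  haveI : NeZero (NumberField.discr K).natAbs := ⟨by rw [hd]; exact hsq.ne_zero⟩
  haveI : NeZero (m * (NumberField.discr K).natAbs) := ⟨mul_ne_zero (NeZero.ne m) (NeZero.ne _)⟩
  have hval := mul_apply_natCast_eq_chiDisc hχ hχq hs hs1 hK2 hsq h4 hdisc hεK
  have hsm : (s * m : ℤ).natAbs = m := by rcases hs1 with rfl | rfl <;> simp
  have habs : (s * m * -(n₀ : ℤ)).natAbs = m * (NumberField.discr K).natAbs := by
    rw [hd, Int.natAbs_mul, Int.natAbs_neg, Int.natAbs_natCast, hsm]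
  have hcop' : (s * m : ℤ).natAbs.Coprime n₀ := by rwa [hsm]
  rcases isFundamental_mul_neg (sign_mul_eq_one_or_isFundamental hχ hχq hs hs1) h4 hsq hcop' with
    ⟨hD1, hDsq, -⟩ | ⟨hD4, hDt, hDsq⟩
  · -- `D' ≡ 1 (mod 4)`: the Jacobi values `J(· | m n₀)` on an odd squarefree modulus
    have hodd : Odd (m * (NumberField.discr K).natAbs) := by
      rw [← habs, Int.natAbs_odd, Int.odd_iff]; omega
    have hsqN : Squarefree (m * (NumberField.discr K).natAbs) := by rw [← habs]; exact Int.squarefree_natAbs.mpr hDsq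
    refine KrizLiBinders.isPrimitive_of_forall_eq_jacobiSym (fun a => ?_) hodd hsqN
    rw [hval a, chiDisc_of_emod_four_eq_one hD1, habs]
  · -- `D' = 4t`, `t ≡ 2, 3 (mod 4)` squarefree: the `[a odd]·J(t | a)` values
    obtain ⟨t, ht⟩ := hD4
    have htt : s * m * -(n₀ : ℤ) / 4 = t := by rw [ht, Int.mul_ediv_cancel_left _ four_ne_zero]
    rw [htt] at hDt hDsq
    have hk : m * (NumberField.discr K).natAbs = 4 * t.natAbs := by rw [← habs, ht, Int.natAbs_mul]; rfl
    have hD1 : (s * m * -(n₀ : ℤ)) % 4 ≠ 1 := by rw [ht]; omega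
    refine KrizLiBinders.isPrimitive_of_forall_eq_kroneckerFour' hk hDt hDsq (fun a => ?_)
    rw [hval a]
    rcases Nat.even_or_odd a with hae | hao
    · rw [chiDisc_of_emod_four_ne_one_of_even hD1 hae, if_pos hae]
    · have hg : Int.gcd (2 : ℤ) (a : ℤ) = 1 := by
        rw [show (2 : ℤ) = ((2 : ℕ) : ℤ) from rfl, Int.gcd_natCast_natCast]
        exact Nat.coprime_two_left.mpr hao
      rw [chiDisc_of_emod_four_ne_one_of_odd hD1 hao, if_neg (Nat.not_even_iff_odd.mpr hao), ht, jacobiSym.mul_left,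
        show (4 : ℤ) = 2 ^ 2 by norm_num, jacobiSym.sq_one' hg, one_mul]

/-- **The Bernoulli number of the dictionary is `bernoulliDisc k D'` read in `ℚ_p`**:
`k`-th generalised Bernoulli number of `(χ↑ε_K↑)~` `= algebraMap ℚ ℚ_p (bernoulliDisc k (e*·(−n₀)))`.
[cite: Washington1997, Prop. 4.1] [cite: MontgomeryVaughan2007, Thm. 9.13] -/
theorem generalizedBernoulli_primitiveCharacter_mul_eq (hχ : χ.IsPrimitive) (hχq : χ.IsQuadratic) (hs : χ (-1) = (s : ℚ_[p]))
    (hs1 : s = 1 ∨ s = -1) (hK2 : Module.finrank ℚ K = 2) (hsq : Squarefree n₀) (h4 : n₀ % 4 = 3)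
    (hdisc : NumberField.discr K = -(n₀ : ℤ)) (hεK : IsKroneckerCharacterOf K εK) (hcop : m.Coprime n₀) (k : ℕ) :
    @generalizedBernoulli ℚ_[p] _ _
        (changeLevel (dvd_mul_right m (NumberField.discr K).natAbs) χ *
          changeLevel (dvd_mul_left (NumberField.discr K).natAbs m) εK).conductor ⟨conductor_ne_zero _⟩ k
        (changeLevel (dvd_mul_right m (NumberField.discr K).natAbs) χ *
          changeLevel (dvd_mul_left (NumberField.discr K).natAbs m) εK).primitiveCharacter =
      algebraMap ℚ ℚ_[p] (bernoulliDisc k (s * m * -(n₀ : ℤ))) := by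
  have hd : (NumberField.discr K).natAbs = n₀ := by rw [hdisc]; simp
  haveI : NeZero (NumberField.discr K).natAbs := ⟨by rw [hd]; exact hsq.ne_zero⟩
  rw [generalizedBernoulli_primitiveCharacter_of_isPrimitive k _ (mul_isPrimitive hχ hχq hs hs1 hK2 hsq h4 hdisc hεK hcop)]
  symm
  refine algebraMap_bernoulliDisc_eq k ?_ _ (mul_apply_natCast_eq_chiDisc hχ hχq hs hs1 hK2 hsq h4 hdisc hεK)
  rw [hd, Int.natAbs_mul, Int.natAbs_neg, Int.natAbs_natCast]
  rcases hs1 with rfl | rfl <;> simp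

end Product

/-! ## §5 Cohen's decomposition of the cut index -/

/-- **`(−1)^k · (m n₀ f²) = (e*·(−n₀)) · f²` is Cohen's decomposition** of the cut index: `e*·(−n₀)` is a fundamental
discriminant or `1` (§1, §2), `f ≥ 1`, and the sign is the parity clause `χ(−1)·(−1)^k = −1`. [cite: Cohen1975, §2 (definition of H(r, N))] -/
theorem isDiscDecomposition_cut {m : ℕ} [NeZero m] {χ : DirichletCharacter ℚ_[p] m} (hχ : χ.IsPrimitive) (hχq : χ.IsQuadratic)
    {s : ℤ} (hs : χ (-1) = (s : ℚ_[p])) (hs1 : s = 1 ∨ s = -1) {k : ℕ} (hpar : χ (-1) * (-1) ^ k = -1) {n₀ f : ℕ}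
    (hsq : Squarefree n₀) (h4 : n₀ % 4 = 3) (hf : 0 < f) (hcop : m.Coprime n₀) :
    IsDiscDecomposition k (m * (n₀ * f ^ 2)) (s * m * -(n₀ : ℤ)) f := by
  refine ⟨?_, hf, ?_⟩
  · have he := sign_mul_eq_one_or_isFundamental hχ hχq hs hs1
    have hcop' : (s * m : ℤ).natAbs.Coprime n₀ := by
      rwa [show (s * m : ℤ).natAbs = m by rcases hs1 with rfl | rfl <;> simp]
    exact Or.inr (isFundamental_mul_neg he h4 hsq hcop')
  · -- the sign: `s · (−1)^k = −1`, hence `(−1)^k = −s`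
    have hsk : (s : ℤ) * (-1) ^ k = -1 := by
      rw [hs] at hpar
      exact_mod_cast hpar
    have hneg : ((-1 : ℤ)) ^ k = -s := by
      rcases hs1 with rfl | rfl
      · linarith
      · linarith
    rw [hneg]; push_cast; ring

/-! ## §6 THE DICTIONARY -/

section Dictionary

variable {m : ℕ} [NeZero m] {χ : DirichletCharacter ℚ_[p] m} {k n₀ f : ℕ} {K : Type} [Field K] [NumberField K]
  {εK : DirichletCharacter ℚ_[p] (NumberField.discr K).natAbs}

/-- **`H(k, m n₀ f²) = L(1 − k, χ_{D'}) · T_k(D', f)`, `D' = χ(−1)·m·(−n₀)`** — Cohen's formula at a cut index, with the sign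
of the class datum. [cite: Cohen1975, §2 (definition of H(r, N))] -/
theorem cohenH_cut_eq (hχ : χ.IsPrimitive) (hχq : χ.IsQuadratic) {s : ℤ} (hs : χ (-1) = (s : ℚ_[p])) (hs1 : s = 1 ∨ s = -1)
    (hpar : χ (-1) * (-1) ^ k = -1) (hsq : Squarefree n₀) (h4 : n₀ % 4 = 3) (hf : 0 < f)
    (hJ : ∀ q : ℕ, q.Prime → q ∣ m → q ≠ 2 → jacobiSym (-((n₀ * f ^ 2 : ℕ) : ℤ)) q = 1) :
    cohenH k (m * (n₀ * f ^ 2)) = lValueDisc k (s * m * -(n₀ : ℤ)) * cohenT k (s * m * -(n₀ : ℤ)) f :=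
  cohenH_eq (isDiscDecomposition_cut hχ hχq hs hs1 hpar hsq h4 hf (coprime_of_cut h4 hJ))

/-- **THE COHEN DICTIONARY ON THE CUT, read in `ℚ_p`:**
`(H(k, m n₀ f²) : ℚ_p) = −T · (k⁻¹ · B_k((χ↑ε_K↑)~))` with `T = T_k(D', f) ∈ ℤ` (`= 1` at `f = 1`), `D' = χ(−1)·m·(−n₀)` —
the Bernoulli number being EXACTLY the one of registry v23's `stub_cutForm` / (CutForm⁶). Hypotheses: the class datum's
`χ` primitive quadratic with the parity clause, the cut's Jacobi clauses, `K` imaginary quadratic of discriminant `−n₀` with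
its Kronecker character `ε_K`. [cite: Cohen1975, §2 (definition of H(r, N))] [cite: MontgomeryVaughan2007, Thm. 9.13] -/
theorem ratCast_cohenH_cut_eq (hχ : χ.IsPrimitive) (hχq : χ.IsQuadratic) {s : ℤ} (hs : χ (-1) = (s : ℚ_[p]))
    (hs1 : s = 1 ∨ s = -1) (hpar : χ (-1) * (-1) ^ k = -1) (hsq : Squarefree n₀) (h4 : n₀ % 4 = 3) (hf : 0 < f)
    (hJ : ∀ q : ℕ, q.Prime → q ∣ m → q ≠ 2 → jacobiSym (-((n₀ * f ^ 2 : ℕ) : ℤ)) q = 1)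
    (hK : IsImaginaryQuadratic K) (hdisc : NumberField.discr K = -(n₀ : ℤ)) (hεK : IsKroneckerCharacterOf K εK) :
    ((cohenH k (m * (n₀ * f ^ 2)) : ℚ) : ℚ_[p]) =
      -(cohenT k (s * m * -(n₀ : ℤ)) f : ℚ_[p]) * ((k : ℚ_[p])⁻¹ * @generalizedBernoulli ℚ_[p] _ _
        (changeLevel (dvd_mul_right m (NumberField.discr K).natAbs) χ *
          changeLevel (dvd_mul_left (NumberField.discr K).natAbs m) εK).conductor ⟨conductor_ne_zero _⟩ k
        (changeLevel (dvd_mul_right m (NumberField.discr K).natAbs) χ *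
          changeLevel (dvd_mul_left (NumberField.discr K).natAbs m) εK).primitiveCharacter) := by
  have hcop := coprime_of_cut h4 hJ
  rw [cohenH_cut_eq hχ hχq hs hs1 hpar hsq h4 hf hJ,
    generalizedBernoulli_primitiveCharacter_mul_eq hχ hχq hs hs1 hK.1 hsq h4 hdisc hεK hcop k, Rat.cast_mul, Rat.cast_intCast,
    lValueDisc, Rat.cast_div, Rat.cast_neg, Rat.cast_natCast, ← eq_ratCast (algebraMap ℚ ℚ_[p])]
  ring

/-- **The (CutForm⁶)-shaped dictionary**: `∃ t : ℤ, (f = 1 → t = 1) ∧ (H(k, m n₀ f²) : ℚ_p) = −t · (k⁻¹ · B_k((χ↑ε_K↑)~))`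
(`t = T_k(D', f)`, `T_k(D', 1) = 1`). With the `p`-integrality of `k⁻¹ B_k((χ↑ε_K↑)~)` (sequel file) this is the dictionary
conjunct of registry v23's `stub_cutForm` for `G := −(reduction of the cut series)`. [cite: Cohen1975, §2 (definition of H(r, N))] -/
theorem exists_int_ratCast_cohenH_cut_eq (hχ : χ.IsPrimitive) (hχq : χ.IsQuadratic) (hpar : χ (-1) * (-1) ^ k = -1)
    (hsq : Squarefree n₀) (h4 : n₀ % 4 = 3) (hf : 0 < f)
    (hJ : ∀ q : ℕ, q.Prime → q ∣ m → q ≠ 2 → jacobiSym (-((n₀ * f ^ 2 : ℕ) : ℤ)) q = 1)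
    (hK : IsImaginaryQuadratic K) (hdisc : NumberField.discr K = -(n₀ : ℤ)) (hεK : IsKroneckerCharacterOf K εK) :
    ∃ t : ℤ, (f = 1 → t = 1) ∧
      ((cohenH k (m * (n₀ * f ^ 2)) : ℚ) : ℚ_[p]) =
        -(t : ℚ_[p]) * ((k : ℚ_[p])⁻¹ * @generalizedBernoulli ℚ_[p] _ _
          (changeLevel (dvd_mul_right m (NumberField.discr K).natAbs) χ *
            changeLevel (dvd_mul_left (NumberField.discr K).natAbs m) εK).conductor ⟨conductor_ne_zero _⟩ k
          (changeLevel (dvd_mul_right m (NumberField.discr K).natAbs) χ *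
            changeLevel (dvd_mul_left (NumberField.discr K).natAbs m) εK).primitiveCharacter) := by
  obtain ⟨s, hs1', hs⟩ := exists_sign_eq_of_charZero χ
  have hs1 : s = 1 ∨ s = -1 := by rcases hs1' with ⟨h, -⟩ | ⟨h, -⟩ <;> simp [h]
  refine ⟨cohenT k (s * m * -(n₀ : ℤ)) f, fun h1 => by rw [h1, cohenT_one],
    ratCast_cohenH_cut_eq hχ hχq hs hs1 hpar hsq h4 hf hJ hK hdisc hεK⟩

end Dictionary

end Summit.BirchSwinnertonDyer.BirchSwinnertonDyer.Theorems.PrintCFram.CohenCut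

end
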